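import Mathlib
import Literature.MathematicalPhysics.QuantumLattice.HubbardBandSectorCountingToolbox
import HarnessLib

/-!
# Route `KLProgramme` — crux K3 `KLRegimeTwoPointLimit` (stmt-HubbardSuperconductivity-19937), support:
# pointwise transversality of the translated band Fermi curve (the geometric heart of DECOMP App. E
# Lemmas E.1 / E.3: transversal particle–particle phase space and the `2k_F` caustic)

Cell `gate-hubbard-kl`, seat p1b (C1 second hand); paper note `HOME/prover-p1b/E1-NOTE.md` §3 Lemma 4.

The two-shell set `{k : |ε(k) - μ| ≤ ε₁, |ε(k - w) - μ| ≤ ε₂}` of the square-lattice band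
`ε(k) = -2(cos k₁ + cos k₂)` (both `k` and `w - k` near the Fermi curve `F_μ`: the particle–particle
phase space at transfer `w = q`; by `p(θ + π) = -p(θ)` also the particle–hole one at transfer `Q = -w`)
is controlled, after the tube reduction in polar coordinates, by the sublevel sets of the level
function of the TRANSLATED curve, `θ ↦ ε(p_μ(θ) - w) - μ`, whose zeros are the torus intersection
points of `F_μ` and `F_μ + w + 2πℤ²`. This file proves the pointwise transversality estimate that
carries the sharp exponents of the one-loop volume bound (Salmhofer, *Renormalization*, Lemma B.28,
there for the sphere only): at every point `θ` where the translated curve is within level distance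
`η` of `F_μ`, if the (half) slope `sin(X - w₁)·X' + sin(Y - w₂)·Y'` is `≤ λ` in absolute value, then
EITHER `w` is within `s_max·C_g(λ + 2 s_max η/Dt_min) + η/Dt_min` of the lattice `2πℤ²` (the COOPER
point: the two translates nearly coincide), OR `w` is within `(A₂/4)·C_g²(λ + …)² + η/Dt_min` of the
CAUSTIC `2F_μ + 2πℤ²` (the `2k_F` kissing configuration) — `klst_transversality_alternative`. Read
contrapositively (`klst_slope_lower_bound`, `klst_slope_lower_bound_on_curve`): the crossing slope is
at least `min{r₀/(s_max C_g), (2/C_g)·√(r₂/A₂)}` (minus an `O(η)` level defect), `r₀` = sup-distance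
of `w` to `2πℤ²`, `r₂` = sup-distance of `w` to `2F_μ + 2πℤ²`: LINEAR in the distance to the Cooper
point, SQUARE-ROOT in the distance to the caustic — the two laws are the even/odd-multiple-of-`π`
readings of ONE alignment lemma (the tree's quantitative Gauss-map injectivity modulo `π`,
`BandSectorCounting.exists_int_near_of_cross_small`, plus localisation `exists_near_curve` and the
parity `band_add_int_mul_pi`). Every constant is a field of the tree's bundle `BandBounds a b` on a
compact level range `[a, b] ⊂ (-4, 0)` (so the statement holds uniformly on the programme window and
the curvature enters only through `amin`, inside `C_g = π c_max/(2 a_min ρ_min²)`).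

Also proved (elementary, used above): the derivative of the translated level function
(`klst_hasDerivAt_transLevel`) and the two-sided second-order Taylor / midpoint bounds for a function
with `|g''| ≤ A` (`klst_abs_taylor_two_le`, `klst_abs_midpoint_le`).

What is deliberately NOT here (next files of the same seat, E1-NOTE §6): the abstract 1D shell-measure
lemma, the second-order non-degeneracy at the caustic, the uniform intersection count, the tube
reduction / area assembly, and the scale sums.

## Sources

* M. Salmhofer, *Renormalization: An Introduction*, Springer 1999, §4.5.3 Lemma 4.10 and App. B.8.1
  Lemma B.28, (B.182)–(B.184) (the one-loop volume bound; spherical case; "generalizing … to the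
  nonspherical case and taking into account that `𝓑` is a torus … requires some care", p. 201).
* G. Benfatto, A. Giuliani, V. Mastropietro, Ann. Henri Poincaré 7 (2006) 809–898, App. A2–A3 (the
  Gauss-map device behind `exists_int_near_of_cross_small`). [BenfattoGiulianiMastropietro2006]
-/

noncomputable section

-- the tree's namespace `Summit.<Summit>.<Problem>.Theorems` repeats the summit name by design (D-0017)
set_option linter.dupNamespace false

open Real Set
open Literature.MathematicalPhysics.QuantumLattice
open Literature.MathematicalPhysics.QuantumLattice.BandSectorCounting

namespace Summit.HubbardSuperconductivity.HubbardSuperconductivity.Theorems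

/-! ### Second-order Taylor and midpoint bounds from a bound on the second derivative -/

/-- Two-sided second-order Taylor bound: if `|g''| ≤ A` everywhere then
`|g(y) - g(x) - g'(x)(y - x)| ≤ (A/2)(y - x)²` for all real `x, y` (from the tree's one-sided
`quadratic_lower_right/left` applied to `g` and `-g`). -/
theorem klst_abs_taylor_two_le {g g' g'' : ℝ → ℝ} (hg : ∀ z, HasDerivAt g (g' z) z)
    (hg' : ∀ z, HasDerivAt g' (g'' z) z) {A : ℝ} (hA : ∀ z, |g'' z| ≤ A) (x y : ℝ) :
    |g y - g x - g' x * (y - x)| ≤ A / 2 * (y - x) ^ 2 := by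
  have hlo : ∀ z, -A ≤ g'' z := fun z => (abs_le.1 (hA z)).1
  have hhi : ∀ z, g'' z ≤ A := fun z => (abs_le.1 (hA z)).2
  have hng : ∀ z, HasDerivAt (fun t => -g t) (-g' z) z := fun z => (hg z).neg
  have hng' : ∀ z, HasDerivAt (fun t => -g' t) (-g'' z) z := fun z => (hg' z).neg
  rcases le_total x y with hxy | hxy
  · have h₁ := quadratic_lower_right hg hg' hxy (c₂ := -A) (fun z _ => hlo z)
    have h₂ := quadratic_lower_right hng hng' hxy (c₂ := -A) (fun z _ => by linarith [hhi z])
    rw [abs_le]; constructor <;> linarith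
  · have h₁ := quadratic_lower_left hg hg' hxy (c₂ := -A) (fun z _ => hlo z)
    have h₂ := quadratic_lower_left hng hng' hxy (c₂ := -A) (fun z _ => by linarith [hhi z])
    rw [abs_le]; constructor <;> linarith

/-- Midpoint (symmetric second difference) bound: if `|g''| ≤ A` everywhere then
`|g(θ) + g(θ + d) - 2 g(θ + d/2)| ≤ (A/4) d²`. -/
theorem klst_abs_midpoint_le {g g' g'' : ℝ → ℝ} (hg : ∀ z, HasDerivAt g (g' z) z)
    (hg' : ∀ z, HasDerivAt g' (g'' z) z) {A : ℝ} (hA : ∀ z, |g'' z| ≤ A) (θ d : ℝ) :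
    |g θ + g (θ + d) - 2 * g (θ + d / 2)| ≤ A / 4 * d ^ 2 := by
  have h₁ := klst_abs_taylor_two_le hg hg' hA (θ + d / 2) θ
  have h₂ := klst_abs_taylor_two_le hg hg' hA (θ + d / 2) (θ + d)
  have e₁ : θ - (θ + d / 2) = -(d / 2) := by ring
  have e₂ : θ + d - (θ + d / 2) = d / 2 := by ring
  rw [e₁] at h₁
  rw [e₂] at h₂
  have hsplit : g θ + g (θ + d) - 2 * g (θ + d / 2) =
      (g θ - g (θ + d / 2) - g' (θ + d / 2) * (-(d / 2))) +
        (g (θ + d) - g (θ + d / 2) - g' (θ + d / 2) * (d / 2)) := by ring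
  rw [hsplit]
  calc |(g θ - g (θ + d / 2) - g' (θ + d / 2) * (-(d / 2))) +
          (g (θ + d) - g (θ + d / 2) - g' (θ + d / 2) * (d / 2))|
      ≤ |g θ - g (θ + d / 2) - g' (θ + d / 2) * (-(d / 2))| +
          |g (θ + d) - g (θ + d / 2) - g' (θ + d / 2) * (d / 2)| := abs_add_le _ _
    _ ≤ A / 2 * (-(d / 2)) ^ 2 + A / 2 * (d / 2) ^ 2 := add_le_add h₁ h₂
    _ = A / 4 * d ^ 2 := by ring

/-! ### The level function of the translated curve -/

section Level

variable {μ : ℝ} (hμ₁ : -4 < μ) (hμ₂ : μ < 0)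
include hμ₁ hμ₂

/-- The derivative of the level function of the translated band Fermi curve,
`θ ↦ ε(p_μ(θ) - w) = ε₂(X_μ(θ) - w₁, Y_μ(θ) - w₂)`, is
`2 (sin(X - w₁)·X' + sin(Y - w₂)·Y')` (i.e. `∇ε(p(θ) - w)·p'(θ)`). -/
theorem klst_hasDerivAt_transLevel (w₁ w₂ θ : ℝ) :
    HasDerivAt (fun t => eps2 (bandX μ t - w₁) (bandY μ t - w₂))
      (2 * (Real.sin (bandX μ θ - w₁) * bandVX μ θ + Real.sin (bandY μ θ - w₂) * bandVY μ θ)) θ := by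
  have hX := (hasDerivAt_bandX hμ₁ hμ₂ θ).sub_const w₁
  have hY := (hasDerivAt_bandY hμ₁ hμ₂ θ).sub_const w₂
  have h := ((hX.cos).add (hY.cos)).const_mul (-2 : ℝ)
  have hfun : (fun t => eps2 (bandX μ t - w₁) (bandY μ t - w₂)) =
      fun t => -2 * (Real.cos (bandX μ t - w₁) + Real.cos (bandY μ t - w₂)) := by
    funext t; simp [eps2]
  rw [hfun]
  exact h.congr_deriv (by ring)

end Level

/-! ### Pointwise transversality of the translated curve -/

section Main

variable {a b : ℝ} (B : BandBounds a b) {μ : ℝ} (hμ : μ ∈ Icc a b)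
include hμ

/-- Midpoint bound for the first coordinate of the band Fermi curve:
`|X(θ) + X(θ + d) - 2 X(θ + d/2)| ≤ (A₂/4) d²` on the level range. -/
theorem klst_abs_midpoint_bandX_le (θ d : ℝ) :
    |bandX μ θ + bandX μ (θ + d) - 2 * bandX μ (θ + d / 2)| ≤ B.A2 / 4 * d ^ 2 := by
  obtain ⟨h1, h2⟩ := B.level hμ
  exact klst_abs_midpoint_le (hasDerivAt_bandX h1 h2) (hasDerivAt_bandVX h1 h2)
    (fun z => B.abs_AX_le μ hμ z) θ d

/-- Midpoint bound for the second coordinate of the band Fermi curve: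
`|Y(θ) + Y(θ + d) - 2 Y(θ + d/2)| ≤ (A₂/4) d²` on the level range. -/
theorem klst_abs_midpoint_bandY_le (θ d : ℝ) :
    |bandY μ θ + bandY μ (θ + d) - 2 * bandY μ (θ + d / 2)| ≤ B.A2 / 4 * d ^ 2 := by
  obtain ⟨h1, h2⟩ := B.level hμ
  exact klst_abs_midpoint_le (hasDerivAt_bandY h1 h2) (hasDerivAt_bandVY h1 h2)
    (fun z => B.abs_AY_le μ hμ z) θ d

/-- **Pointwise transversality of the translated curve (the alternative).** Let `μ ± η` lie in the
level range, `w = (w₁, w₂) ∈ ℝ²`, and let `θ` be a point where the translated curve is `η`-close in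
level to `F_μ`: `|ε(p_μ(θ) - w) - μ| ≤ η`. If the half-slope
`sin(X(θ) - w₁)·X'(θ) + sin(Y(θ) - w₂)·Y'(θ)` is `≤ λ` in absolute value, then there are a lattice
vector `2π(m₀, m₁)` and an alignment defect `d`, `|d| ≤ C_g(λ + 2 s_max η/Dt_min)`, such that EITHER
`w - 2π m` has sup-norm `≤ s_max |d| + η/Dt_min` (the two curves nearly coincide: `w` is at the
Cooper point), OR `w - 2π m - 2 p_μ(θ + d/2)` has sup-norm `≤ (A₂/4) d² + η/Dt_min` (`w` is on the
caustic `2F_μ`, the `2k_F` kissing configuration, up to a SECOND-order defect). Proof: localise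
`p(θ) - w` on the curve modulo `2πℤ²` (`exists_near_curve`), compare the slope with the mixed product
`sin X(φ)X'(θ) + sin Y(φ)Y'(θ) ∝ sin(α(φ) - α(θ))`, invoke the quantitative Gauss-map injectivity
modulo `π` (`exists_int_near_of_cross_small`) and split on the parity of the multiple of `π`
(`band_add_int_mul_pi`): even gives a first-order chord, odd a chord sum, i.e. twice the midpoint up
to `(A₂/4)d²`. -/
theorem klst_transversality_alternative {η lam w₁ w₂ θ : ℝ}
    (hlo : a ≤ μ - η) (hhi : μ + η ≤ b)
    (hG : |eps2 (bandX μ θ - w₁) (bandY μ θ - w₂) - μ| ≤ η)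
    (hG' : |Real.sin (bandX μ θ - w₁) * bandVX μ θ + Real.sin (bandY μ θ - w₂) * bandVY μ θ| ≤ lam) :
    ∃ (m₀ m₁ : ℤ) (d : ℝ), |d| ≤ B.Cg * (lam + 2 * B.smax * (η / B.Dtmin)) ∧
      ((|w₁ - m₀ * (2 * π)| ≤ B.smax * |d| + η / B.Dtmin ∧
          |w₂ - m₁ * (2 * π)| ≤ B.smax * |d| + η / B.Dtmin) ∨
        (|w₁ - m₀ * (2 * π) - 2 * bandX μ (θ + d / 2)| ≤ B.A2 / 4 * d ^ 2 + η / B.Dtmin ∧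
          |w₂ - m₁ * (2 * π) - 2 * bandY μ (θ + d / 2)| ≤ B.A2 / 4 * d ^ 2 + η / B.Dtmin)) := by
  obtain ⟨h1, h2⟩ := B.level hμ
  -- localisation of `p(θ) - w` on the curve modulo `2πℤ²`
  obtain ⟨φ, m₀, m₁, hx, hy⟩ := exists_near_curve B hμ hG hlo hhi
  -- the sines of the translated coordinates are close to those at the curve point `φ`
  have hsx : |Real.sin (bandX μ φ) - Real.sin (bandX μ θ - w₁)| ≤ η / B.Dtmin := by
    rw [abs_sub_comm, ← Real.sin_sub_int_mul_two_pi (bandX μ θ - w₁) m₀]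
    exact (Real.abs_sin_sub_sin_le _ _).trans hx
  have hsy : |Real.sin (bandY μ φ) - Real.sin (bandY μ θ - w₂)| ≤ η / B.Dtmin := by
    rw [abs_sub_comm, ← Real.sin_sub_int_mul_two_pi (bandY μ θ - w₂) m₁]
    exact (Real.abs_sin_sub_sin_le _ _).trans hy
  -- hence the mixed product `sin X(φ)·X'(θ) + sin Y(φ)·Y'(θ)` is small
  have hVX := B.abs_VX_le μ hμ θ
  have hVY := B.abs_VY_le μ hμ θ
  have he0 : 0 ≤ η / B.Dtmin := le_trans (abs_nonneg _) hsx
  have hcross : |Real.sin (bandX μ φ) * bandVX μ θ + Real.sin (bandY μ φ) * bandVY μ θ| ≤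
      lam + 2 * B.smax * (η / B.Dtmin) := by
    have hdiff := abs_two_term_sub_le (Real.sin (bandX μ φ)) (Real.sin (bandY μ φ))
      (Real.sin (bandX μ θ - w₁)) (Real.sin (bandY μ θ - w₂)) (bandVX μ θ) (bandVY μ θ)
    have h₁ : |Real.sin (bandX μ φ) - Real.sin (bandX μ θ - w₁)| * |bandVX μ θ| ≤
        η / B.Dtmin * B.smax := mul_le_mul hsx hVX (abs_nonneg _) he0
    have h₂ : |Real.sin (bandY μ φ) - Real.sin (bandY μ θ - w₂)| * |bandVY μ θ| ≤
        η / B.Dtmin * B.smax := mul_le_mul hsy hVY (abs_nonneg _) he0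
    have htri := abs_sub_abs_le_abs_sub
      (Real.sin (bandX μ φ) * bandVX μ θ + Real.sin (bandY μ φ) * bandVY μ θ)
      (Real.sin (bandX μ θ - w₁) * bandVX μ θ + Real.sin (bandY μ θ - w₂) * bandVY μ θ)
    linarith
  -- quantitative injectivity of the Gauss map modulo `π`
  obtain ⟨j, hj⟩ := exists_int_near_of_cross_small B hμ hcross
  set d := φ - θ - j * π with hd
  have hφ : φ = θ + d + j * π := by rw [hd]; ring
  obtain ⟨σ, hσ, hX, hY, -, -⟩ := band_add_int_mul_pi h1 h2 (θ + d) j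
  rw [← hφ] at hX hY
  have cast0 : ((-m₀ : ℤ) : ℝ) * (2 * π) = -((m₀ : ℝ) * (2 * π)) := by push_cast; ring
  have cast1 : ((-m₁ : ℤ) : ℝ) * (2 * π) = -((m₁ : ℝ) * (2 * π)) := by push_cast; ring
  refine ⟨-m₀, -m₁, d, hj, ?_⟩
  rcases hσ with rfl | rfl
  · -- even multiple of `π`: the two curves nearly coincide, `w` is near the lattice
    left
    have hθd : |θ - (θ + d)| = |d| := by rw [show θ - (θ + d) = -d by ring, abs_neg]
    have hLX := abs_bandX_sub_le B hμ θ (θ + d)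
    have hLY := abs_bandY_sub_le B hμ θ (θ + d)
    rw [hθd] at hLX hLY
    rw [one_mul] at hX hY
    constructor
    · have hrw : w₁ - ((-m₀ : ℤ) : ℝ) * (2 * π) =
          (bandX μ θ - bandX μ (θ + d)) - (bandX μ θ - w₁ - m₀ * (2 * π) - bandX μ φ) := by
        rw [cast0, hX]; ring
      rw [hrw]
      exact (abs_sub _ _).trans (add_le_add hLX hx)
    · have hrw : w₂ - ((-m₁ : ℤ) : ℝ) * (2 * π) =
          (bandY μ θ - bandY μ (θ + d)) - (bandY μ θ - w₂ - m₁ * (2 * π) - bandY μ φ) := by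
        rw [cast1, hY]; ring
      rw [hrw]
      exact (abs_sub _ _).trans (add_le_add hLY hy)
  · -- odd multiple of `π`: `p(φ) = -p(θ + d)`, `w` is near twice the midpoint, i.e. on the caustic
    right
    have hMX := klst_abs_midpoint_bandX_le B hμ θ d
    have hMY := klst_abs_midpoint_bandY_le B hμ θ d
    constructor
    · have hrw : w₁ - ((-m₀ : ℤ) : ℝ) * (2 * π) - 2 * bandX μ (θ + d / 2) =
          (bandX μ θ + bandX μ (θ + d) - 2 * bandX μ (θ + d / 2)) -
            (bandX μ θ - w₁ - m₀ * (2 * π) - bandX μ φ) := by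
        rw [cast0, hX]; ring
      rw [hrw]
      exact (abs_sub _ _).trans (add_le_add hMX hx)
    · have hrw : w₂ - ((-m₁ : ℤ) : ℝ) * (2 * π) - 2 * bandY μ (θ + d / 2) =
          (bandY μ θ + bandY μ (θ + d) - 2 * bandY μ (θ + d / 2)) -
            (bandY μ θ - w₂ - m₁ * (2 * π) - bandY μ φ) := by
        rw [cast1, hY]; ring
      rw [hrw]
      exact (abs_sub _ _).trans (add_le_add hMY hy)

/-- **Slope lower bound (quantitative contrapositive).** If `w` keeps sup-distance `≥ r₀` from the
lattice `2πℤ²` and `≥ r₂` from the caustic `2F_μ + 2πℤ²`, then at every point `θ` where the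
translated curve is `η`-close in level to `F_μ`, the half-slope exceeds every `λ` with
`s_max C_g(λ + 2 s_max η/Dt_min) + η/Dt_min < r₀` and `(A₂/4)(C_g(λ + 2 s_max η/Dt_min))² + η/Dt_min < r₂`
— i.e. the crossing slope is `≥ c_B·min{r₀, √r₂} - C_B η`: linear in the distance to the Cooper
point, square-root in the distance to the caustic. -/
theorem klst_slope_lower_bound {η lam r₀ r₂ w₁ w₂ θ : ℝ}
    (hlo : a ≤ μ - η) (hhi : μ + η ≤ b)
    (hG : |eps2 (bandX μ θ - w₁) (bandY μ θ - w₂) - μ| ≤ η)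
    (hr₀ : ∀ m₀ m₁ : ℤ, r₀ ≤ max |w₁ - m₀ * (2 * π)| |w₂ - m₁ * (2 * π)|)
    (hr₂ : ∀ (m₀ m₁ : ℤ) (ψ : ℝ),
      r₂ ≤ max |w₁ - m₀ * (2 * π) - 2 * bandX μ ψ| |w₂ - m₁ * (2 * π) - 2 * bandY μ ψ|)
    (h₀ : B.smax * (B.Cg * (lam + 2 * B.smax * (η / B.Dtmin))) + η / B.Dtmin < r₀)
    (h₂ : B.A2 / 4 * (B.Cg * (lam + 2 * B.smax * (η / B.Dtmin))) ^ 2 + η / B.Dtmin < r₂) :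
    lam < |Real.sin (bandX μ θ - w₁) * bandVX μ θ + Real.sin (bandY μ θ - w₂) * bandVY μ θ| := by
  by_contra hcon
  push Not at hcon
  obtain ⟨m₀, m₁, d, hd, halt⟩ := klst_transversality_alternative B hμ hlo hhi hG hcon
  rcases halt with ⟨hx, hy⟩ | ⟨hx, hy⟩
  · have hmax := max_le hx hy
    have hmul : B.smax * |d| ≤ B.smax * (B.Cg * (lam + 2 * B.smax * (η / B.Dtmin))) :=
      mul_le_mul_of_nonneg_left hd B.smax_pos.le
    linarith [hr₀ m₀ m₁]
  · have hmax := max_le hx hy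
    have hd2 : d ^ 2 ≤ (B.Cg * (lam + 2 * B.smax * (η / B.Dtmin))) ^ 2 := by
      have h0 : 0 ≤ B.Cg * (lam + 2 * B.smax * (η / B.Dtmin)) := le_trans (abs_nonneg d) hd
      rw [← sq_abs d]
      exact pow_le_pow_left₀ (abs_nonneg d) hd 2
    have hmul : B.A2 / 4 * d ^ 2 ≤ B.A2 / 4 * (B.Cg * (lam + 2 * B.smax * (η / B.Dtmin))) ^ 2 :=
      mul_le_mul_of_nonneg_left hd2 (by linarith [B.A2_pos])
    linarith [hr₂ m₀ m₁ (θ + d / 2)]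

/-- **Slope lower bound at the intersection points.** At every torus intersection point of `F_μ`
and `F_μ + w` (a `θ` with `ε(p_μ(θ) - w) = μ`), the half crossing slope
`|sin(X - w₁)X' + sin(Y - w₂)Y'| = |½∇ε(p(θ) - w)·p'(θ)|` is at least
`min{r₀/(s_max C_g), (2/C_g)·√(r₂/A₂)}`, where `r₀`, `r₂` are lower bounds of the sup-distances of
`w` to the lattice `2πℤ²` (Cooper point) and to the caustic `2F_μ + 2πℤ²`. In particular the two
translates are tangent only for `w ∈ 2πℤ² ∪ (2F_μ + 2πℤ²)`. -/
theorem klst_slope_lower_bound_on_curve {r₀ r₂ w₁ w₂ θ : ℝ}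
    (hG : eps2 (bandX μ θ - w₁) (bandY μ θ - w₂) = μ)
    (hr₀ : ∀ m₀ m₁ : ℤ, r₀ ≤ max |w₁ - m₀ * (2 * π)| |w₂ - m₁ * (2 * π)|)
    (hr₂ : ∀ (m₀ m₁ : ℤ) (ψ : ℝ),
      r₂ ≤ max |w₁ - m₀ * (2 * π) - 2 * bandX μ ψ| |w₂ - m₁ * (2 * π) - 2 * bandY μ ψ|) :
    min (r₀ / (B.smax * B.Cg)) (2 / B.Cg * Real.sqrt (r₂ / B.A2)) ≤
      |Real.sin (bandX μ θ - w₁) * bandVX μ θ + Real.sin (bandY μ θ - w₂) * bandVY μ θ| := by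
  have hs := B.smax_pos
  have hC := B.Cg_pos
  have hA := B.A2_pos
  have hG0 : |eps2 (bandX μ θ - w₁) (bandY μ θ - w₂) - μ| ≤ 0 := by rw [hG, sub_self, abs_zero]
  have hlo : a ≤ μ - 0 := by rw [sub_zero]; exact hμ.1
  have hhi : μ + 0 ≤ b := by rw [add_zero]; exact hμ.2
  refine le_of_forall_lt (fun c hc => ?_)
  rcases lt_or_ge c 0 with hc0 | hc0
  · exact hc0.trans_le (abs_nonneg _)
  · have hc₁ : c < r₀ / (B.smax * B.Cg) := hc.trans_le (min_le_left _ _)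
    have hc₂ : c < 2 / B.Cg * Real.sqrt (r₂ / B.A2) := hc.trans_le (min_le_right _ _)
    refine klst_slope_lower_bound B hμ hlo hhi hG0 hr₀ hr₂ ?_ ?_
    · have : B.smax * (B.Cg * c) < r₀ := by
        rw [lt_div_iff₀ (mul_pos hs hC)] at hc₁; nlinarith
      simpa using this
    · -- from `c < (2/C_g)√(r₂/A₂)`: `(C_g c/2)² < r₂/A₂`
      have hr2pos : 0 < r₂ := by
        by_contra hneg
        push Not at hneg
        have : Real.sqrt (r₂ / B.A2) = 0 :=
          Real.sqrt_eq_zero'.2 (div_nonpos_of_nonpos_of_nonneg hneg hA.le)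
        rw [this, mul_zero] at hc₂
        linarith
      have hlt : B.Cg * c / 2 < Real.sqrt (r₂ / B.A2) := by
        rw [div_lt_iff₀ (by norm_num : (0:ℝ) < 2)]
        calc B.Cg * c = B.Cg * c := rfl
          _ < B.Cg * (2 / B.Cg * Real.sqrt (r₂ / B.A2)) := mul_lt_mul_of_pos_left hc₂ hC
          _ = Real.sqrt (r₂ / B.A2) * 2 := by field_simp
      have hnn : 0 ≤ B.Cg * c / 2 := by positivity
      have hsq : (B.Cg * c / 2) ^ 2 < r₂ / B.A2 := by
        calc (B.Cg * c / 2) ^ 2 < Real.sqrt (r₂ / B.A2) ^ 2 := by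
              exact pow_lt_pow_left₀ hlt hnn (by norm_num)
          _ = r₂ / B.A2 := Real.sq_sqrt (div_nonneg hr2pos.le hA.le)
      have : B.A2 / 4 * (B.Cg * c) ^ 2 < r₂ := by
        rw [lt_div_iff₀ hA] at hsq; nlinarith
      simpa using this

end Main

end Summit.HubbardSuperconductivity.HubbardSuperconductivity.Theorems

end
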